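import Summits.QuantumFields.YangMills.Theorems.BalabanUVNodesN15KingModelPotentialDressedSite
import Summits.QuantumFields.YangMills.Theorems.BalabanUVNodesN15KingModelNE2

/-!
# N15 (NE2⁺), King-model rung, part 16: the OPERATOR layer for the dressed covariances with the potential LIVE; `N15At` on dressed carriers

Cell `pub-ymgap-dag-n15-d` (R134 acceleration DAG, node N15 = NE2, strategy s3 KING-MODEL RUNG), part 16.  n15-e's part 1 (`…KingModelNE2`)
proved the node's K4 face `YMDAG.UVSplit.N15At` — `NE2PlusOperator ∧ NE2PlusSite ∧ NE2PlusUnit` BY NAME — on the King carriers, whose background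
sort is the one-point carrier (A = 0 content inside NE2⁺'s type).  Parts 10d ∕ 15 of this lineage inhabited the UNIT and SITE layers by name on
families whose background sort is LIVE (potential towers, the predicates' (3.35)∕(3.36) windows genuinely quantified).  This file adds the OPERATOR
layer and assembles the face:

* §1 `torOps K ν` — the four [B9] (3.42) entry operators `![𝔎, ∇_ν𝔎, 𝔎∇_ν*, Δ𝔎]` of a unit-lattice kernel matrix `K` (n15-e's `fwdDiff` ∕ `adjDiff` ∕
  `lapOp`), and `torOps_single_le`: a pointwise bound `|K(x, z)| ≤ K_c·e^{−δ|x−z|}` gives `|T_m δ_z (x)| ≤ 4(d+1)e^{δ}K_c·e^{−δ|x−z|}` (part 1's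
  unit-shift bookkeeping, kernel-generic);
* §2 the dressed operator family `kingOpSC` on the index `KingPotIdx d × Fin (d+1)` (direction `ν` for the derivative entries; instances
  `kingInstanceSC` of part 15, background sort `potBgSC` = size ∧ coherence): the entry operators of the matrix `(y, y′) ↦ C^{(k+1)}_v(y, y′) − C^{(k)}_v(y, y′)`
  (part 10d's dressed unit kernel `kingKerVW`), and `etaRateIneq342_kingOpSC_of_le` (a pointwise bound with rate `(L^k)^{−γ}` gives `EtaRateIneq342`);
* §3 ★★ `ne2PlusOperator_kingSC : NE2PlusOperator c₃₅ (kingInstanceSCν L s) (kingOpSC L a m² s)` BY NAME — from part 10d's uniform dressed (4.38)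
  (`ne2PlusUnit_kingVW`), the rate `θ^k` rewritten as `(L^k)^{−γ}` with `γ = −log θ ∕ log L > 0`; `ne2ZeroOperator_kingSC`;
* §4 ★★★ `n15At_kingModelSC : N15At (kingCarriersSC d L a m² s c₃₅ p)` — THE NODE'S K4 FACE ON CARRIERS WITH A LIVE BACKGROUND SORT: operator layer
  (this file), site layer (part 15's `ne2PlusSite_kingHSC`, the dressed minimiser's sup entries), unit layer (part 15's `ne2PlusUnit_kingSC`, the
  dressed covariances), all with constants uniform over the (3.35)-window of `potBgSC`; the index block is inhabited.

HONEST SCOPE.  King's A = 0 scalar model on King-admissible tori `Π ℤ∕(2L^{e+1})`, odd `L ≥ 3`, `a, m² > 0`, `c₃₅ > 0`, coherence rate `0 ≤ s ≤ L^{−1∕2}`;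
the background sort is a sort of scalar POTENTIAL towers (NOT gauge fields) in OUR slot reading ((3.35) := size ∧ coherence — see part 15 for why the
coherence letter must sit in the slot the predicates read); every site has unit length, so the (3.42) prefactors are `1`; NOT Bałaban's carriers of
record (NODE 00), NOT a discharge of N15, count-neutral; nothing in `YMDAG.*` is touched (only `YMDAG.UVSplit.NE2Carriers` ∕ `N15At` are READ).

References: [B9] = Bałaban, Commun. Math. Phys. 102 (1985) 385–462, (3.35)–(3.36) p.396, Thm 3.1 (3.42) p.397, Thm 3.14 pp.426–427, Thm 3.15 p.432
(bib key `Balaban1985BackgroundPropagators`); C. King, Commun. Math. Phys. 103 (1986) 323–349, Prop. 3.8 (3.71) p.664, Lemma 4.5 (4.38) p.674 (bib key `King1986`).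
-/

noncomputable section
open scoped BigOperators
open Finset

namespace Summit.QuantumFields.YangMills.BalabanUVNodes.N15.KingModel

open Literature.MathematicalPhysics.QuantumFieldTheory.Balaban1983to89 hiding blockOf
open Literature.MathematicalPhysics.QuantumFieldTheory.Balaban1983to89.B11SectG (BlockNorm HasMaj)
open Literature.MathematicalPhysics.QuantumFieldTheory.Balaban1983to89.T4EtaRate (PairedInstance EtaPairing EtaRateIneq342 NE2PlusOperator
  NE2ZeroOperator NE2PlusSite NE2PlusUnit rateFactor ne2Zero_of_ne2Plus)
open Literature.MathematicalPhysics.QuantumFieldTheory.Balaban1983to89.T4EtaRateCoeffDefect (fibre mem_fibre)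
open Literature.MathematicalPhysics.QuantumFieldTheory.Balaban1983to89.B5Prop11Plancherel (Tor fine unitVec)
open Literature.MathematicalPhysics.QuantumFieldTheory.King1986.Torus (tdistT tdistT_nonneg)
open Summit.QuantumFields.YangMills.BalabanUVNodes.N15.OperatorReadout (opGeo opFamily opGeo_len rateFactor_opGeo etaRateIneq342_of_hasMaj)
open Summit.QuantumFields.YangMills.BalabanUVNodes.N15.DefectKernel (hasMaj_ofBlocks_of_entry_le)
open YMDAG.UVSplit (NE2Carriers N15At)
open Real

variable {d : ℕ}

/-! ## §1 The four (3.42) entry operators of a unit-lattice kernel matrix -/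

section TorOps

variable (Kt : Fin (d + 1) → ℕ) [∀ μ, NeZero (Kt μ)]

/-- THE FOUR (3.42) ENTRY OPERATORS `![𝔎, ∇_ν𝔎, 𝔎∇_ν*, Δ𝔎]` of a kernel matrix `K` on the unit lattice `Π ℤ∕Kt_μ` (`U ≡ 1` unit-lattice
derivatives: n15-e's `fwdDiff`, `adjDiff`, `lapOp`). [cite: Balaban1985BackgroundPropagators, (3.42) p.397 (the four entries: shape)] -/
def torOps (K : Matrix (Tor Kt) (Tor Kt) ℝ) (ν : Fin (d + 1)) : Fin 4 → ((Tor Kt → ℝ) →ₗ[ℝ] (Tor Kt → ℝ)) :=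
  fun m => ![Matrix.mulVecLin K, fwdDiff Kt ν ∘ₗ Matrix.mulVecLin K, Matrix.mulVecLin K ∘ₗ adjDiff Kt ν, lapOp Kt ∘ₗ Matrix.mulVecLin K] m

/-- The point-source entries of the kernel operator are the kernel: `𝔎(δ_z)(x) = K(x, z)`. [folklore] -/
theorem mulVecLin_single_apply (K : Matrix (Tor Kt) (Tor Kt) ℝ) (z x : Tor Kt) : Matrix.mulVecLin K (Pi.single z 1) x = K x z := by
  rw [Matrix.mulVecLin_apply, Matrix.mulVec_single_one]
  rfl

/-- **POINT-SOURCE ENTRIES FROM A POINTWISE KERNEL BOUND** (`δ ≥ 0`, `K_c ≥ 0`): if `|K(x, z)| ≤ K_c·e^{−δ|x−z|_T}` then every entry operator has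
`|T_m(δ_z)(x)| ≤ 4(d+1)e^{δ}K_c·e^{−δ|x−z|_T}` — entry 0 is the bound, entries 1–3 are sums of at most `2(d+1)` unit-shifted copies (n15-e's
`exp_shift_*_le`). [cite: Balaban1985BackgroundPropagators, (3.42) p.397 (shape); King1986, Lemma 4.5 (4.38) p.674 (A = 0 model)] -/
theorem torOps_single_le {K : Matrix (Tor Kt) (Tor Kt) ℝ} {Kc δ : ℝ} (hδ : 0 ≤ δ) (hKc : 0 ≤ Kc)
    (hK : ∀ x z : Tor Kt, |K x z| ≤ Kc * Real.exp (-(δ * tdistT Kt x z))) (ν : Fin (d + 1)) (m : Fin 4) (x z : Tor Kt) :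
    |torOps Kt K ν m (Pi.single z 1) x| ≤ 4 * ((d : ℝ) + 1) * Real.exp δ * Kc * Real.exp (-(δ * tdistT Kt x z)) := by
  have hE1 : 1 ≤ Real.exp δ := Real.one_le_exp hδ
  set E := fun y : Tor Kt => Real.exp (-(δ * tdistT Kt y z)) with hEdef
  have hE0 : ∀ y, 0 ≤ E y := fun y => Real.exp_nonneg _
  have hb : ∀ y, |Matrix.mulVecLin K (Pi.single z 1) y| ≤ Kc * E y := fun y => by
    rw [mulVecLin_single_apply]; exact hK y z
  have hb_add : ∀ (y) (μ : Fin (d + 1)), |Matrix.mulVecLin K (Pi.single z 1) (y + unitVec Kt μ)| ≤ Kc * (Real.exp δ * E y) :=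
    fun y μ => (hb _).trans (mul_le_mul_of_nonneg_left (exp_shift_add_le Kt hδ y z μ) hKc)
  have hb_sub : ∀ (y) (μ : Fin (d + 1)), |Matrix.mulVecLin K (Pi.single z 1) (y - unitVec Kt μ)| ≤ Kc * (Real.exp δ * E y) :=
    fun y μ => (hb _).trans (mul_le_mul_of_nonneg_left (exp_shift_sub_le Kt hδ y z μ) hKc)
  have hb_src : ∀ (y) (μ : Fin (d + 1)), |Matrix.mulVecLin K (Pi.single (z + unitVec Kt μ) 1) y| ≤ Kc * (Real.exp δ * E y) :=
    fun y μ => by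
      rw [mulVecLin_single_apply]
      exact (hK y _).trans (mul_le_mul_of_nonneg_left (exp_shift_source_le Kt hδ y z μ) hKc)
  set P := Kc * E x with hP
  set R := Real.exp δ * P with hR
  have hP0 : 0 ≤ P := mul_nonneg hKc (hE0 x)
  have hPR : P ≤ R := le_mul_of_one_le_left hP0 hE1
  have hR0 : 0 ≤ R := hP0.trans hPR
  have hKcR : Kc * (Real.exp δ * E x) = R := by rw [hR, hP]; ring
  have hd1 : (1 : ℝ) ≤ (d : ℝ) + 1 := by
    have : (0 : ℝ) ≤ d := Nat.cast_nonneg d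
    linarith
  have hT : 4 * ((d : ℝ) + 1) * Real.exp δ * Kc * E x = 4 * ((d : ℝ) + 1) * R := by rw [hR, hP]; ring
  have h4R : 4 * R ≤ 4 * ((d : ℝ) + 1) * R := by nlinarith
  rw [hT]
  fin_cases m
  · show |Matrix.mulVecLin K (Pi.single z 1) x| ≤ _
    have h2 := hb x
    linarith
  · show |(fwdDiff Kt ν ∘ₗ Matrix.mulVecLin K) (Pi.single z 1) x| ≤ _
    rw [LinearMap.comp_apply, fwdDiff_apply]
    refine (abs_sub _ _).trans ?_
    have h1 := hb_add x ν
    have h2 := hb x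
    rw [hKcR] at h1
    linarith
  · show |(Matrix.mulVecLin K ∘ₗ adjDiff Kt ν) (Pi.single z 1) x| ≤ _
    rw [LinearMap.comp_apply, adjDiff_single, map_sub, Pi.sub_apply]
    refine (abs_sub _ _).trans ?_
    have h1 := hb_src x ν
    have h2 := hb x
    rw [hKcR] at h1
    linarith
  · show |(lapOp Kt ∘ₗ Matrix.mulVecLin K) (Pi.single z 1) x| ≤ _
    rw [LinearMap.comp_apply, lapOp_apply]
    refine (Finset.abs_sum_le_sum_abs _ _).trans ?_
    have hterm : ∀ μ : Fin (d + 1),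
        |Matrix.mulVecLin K (Pi.single z 1) (x + unitVec Kt μ) + Matrix.mulVecLin K (Pi.single z 1) (x - unitVec Kt μ)
            - 2 * Matrix.mulVecLin K (Pi.single z 1) x| ≤ 4 * R := fun μ => by
      have h1 := hb_add x μ
      have h2 := hb_sub x μ
      have h3 := hb x
      rw [hKcR] at h1 h2
      calc _ ≤ |Matrix.mulVecLin K (Pi.single z 1) (x + unitVec Kt μ) + Matrix.mulVecLin K (Pi.single z 1) (x - unitVec Kt μ)|
              + |2 * Matrix.mulVecLin K (Pi.single z 1) x| := abs_sub _ _
        _ ≤ (|Matrix.mulVecLin K (Pi.single z 1) (x + unitVec Kt μ)| + |Matrix.mulVecLin K (Pi.single z 1) (x - unitVec Kt μ)|)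
              + 2 * |Matrix.mulVecLin K (Pi.single z 1) x| := by
            refine add_le_add (abs_add_le _ _) (le_of_eq ?_)
            rw [abs_mul, abs_two]
        _ ≤ 4 * R := by linarith
    calc ∑ μ : Fin (d + 1), |Matrix.mulVecLin K (Pi.single z 1) (x + unitVec Kt μ)
            + Matrix.mulVecLin K (Pi.single z 1) (x - unitVec Kt μ) - 2 * Matrix.mulVecLin K (Pi.single z 1) x|
        ≤ ∑ _μ : Fin (d + 1), 4 * R := Finset.sum_le_sum fun μ _ => hterm μ
      _ = 4 * ((d : ℝ) + 1) * R := by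
          rw [Finset.sum_const, Finset.card_univ, Fintype.card_fin, nsmul_eq_mul]; push_cast; ring

/-- A rate `θ^k` with `0 < θ < 1` is a [B9] rate factor `(L^k)^{−γ}` with `γ = −log θ ∕ log L > 0` (`L > 1`). [folklore] -/
theorem pow_eq_rpow_rate {θ Lr : ℝ} (hθ0 : 0 < θ) (hθ1 : θ < 1) (hL : 1 < Lr) :
    0 < -Real.log θ / Real.log Lr ∧ ∀ k : ℕ, θ ^ k = (Lr ^ k) ^ (-(-Real.log θ / Real.log Lr)) := by
  have hlogL : 0 < Real.log Lr := Real.log_pos hL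
  have hlogθ : Real.log θ < 0 := Real.log_neg hθ0 hθ1
  refine ⟨div_pos (neg_pos.mpr hlogθ) hlogL, fun k => ?_⟩
  have hθeq : Lr ^ (-(-Real.log θ / Real.log Lr)) = θ := by
    rw [neg_div, neg_neg, Real.rpow_def_of_pos (by linarith), mul_comm, div_mul_cancel₀ _ hlogL.ne', Real.exp_log hθ0]
  rw [← Real.rpow_pow_comm (by linarith), hθeq]

end TorOps

/-! ## §2 The dressed operator family on `KingPotIdx d × Fin (d+1)` -/

section Family

variable (L : ℕ) [NeZero L]

/-- THE DRESSED KING FAMILY WITH A DIRECTION: index `(i, ν)`, instance part 15's `kingInstanceSC i` (size-and-coherence potential sort live).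
[cite: Balaban1985BackgroundPropagators, Thm 3.1 p.397 + Thm 3.14 pp.426–427 (typing template)] -/
def kingInstanceSCν (s : ℝ) (j : KingPotIdx d × Fin (d + 1)) : PairedInstance := kingInstanceSC L s j.1

/-- THE DRESSED UNIT-LATTICE KERNEL MATRIX at an index and a tower: `(y, y′) ↦ C^{(k+1)}_v(y, y′) − C^{(k)}_v(y, y′)` (part 10d's `kingKerVW` entries).
[cite: King1986, Lemma 4.5 (4.38) p.674 (the differenced object, A = 0)] -/
def kingKerMat (a m2 s : ℝ) (i : KingPotIdx d) (v : ∀ N : ℕ, Tor (fine N (kingU d L i.e)) → ℝ) :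
    Matrix (Tor (kingU d L i.e)) (Tor (kingU d L i.e)) ℝ :=
  fun y y' => (kingKerVW L a m2 s i).ker v y y'

/-- THE FOUR DRESSED ENTRY OPERATORS at index `(i, ν)` and tower `v`. [cite: Balaban1985BackgroundPropagators, (3.42) p.397 (the four entries: shape)] -/
def kingOpsSC (a m2 s : ℝ) (j : KingPotIdx d × Fin (d + 1)) :
    Fin 4 → (potBgSC L s (kingU d L j.1.e)).Cfg → ((Tor (kingU d L j.1.e) → ℝ) →ₗ[ℝ] (Tor (kingU d L j.1.e) → ℝ)) :=
  fun m v => torOps (kingU d L j.1.e) (kingKerMat L a m2 s j.1 v) j.2 m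

/-- THE DRESSED OPERATOR-LAYER KERNEL FAMILY: n15-b's `opFamily` of the four dressed entry operators (every site its own block).
[cite: Balaban1985BackgroundPropagators, (3.42) p.397 (the four sup entries: shape)] -/
def kingOpSC (a m2 s : ℝ) (j : KingPotIdx d × Fin (d + 1)) : B9.KernelFamily (kingInstanceSCν L s j).gc (kingInstanceSCν L s j).Bf :=
  show B9.KernelFamily (kingGeoCV L j.1) (potBgSC L s (kingU d L j.1.e)) from
    opFamily (g := kingGeo L j.1.k (kingU d L j.1.e) j.1.Msz) (fun x => x) (fun x => x) (kingOpsSC L a m2 s j)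

/-- **`EtaRateIneq342` FOR THE DRESSED ENTRY FAMILY FROM A POINTWISE KERNEL BOUND** (`L ≥ 2`, `B ≥ 0`, `δ ≥ 0`): if at the tower `v`
`|C^{(k+1)}_v(x, z) − C^{(k)}_v(x, z)| ≤ B·e^{−δ|x−z|_T}·(L^k)^{−γ}`, then `EtaRateIneq342 (kingOpSC j) (4(d+1)e^{δ}B) δ γ v` — unit lengths, (3.42)
prefactors `1`, rate factor `(L^k)^{−γ}`, block majorants by n15-a's `hasMaj_ofBlocks_of_entry_le`, the inequality by n15-b's `etaRateIneq342_of_hasMaj`.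
[cite: Balaban1985BackgroundPropagators, Thm 3.1 (3.42) p.397 (shape); King1986, Lemma 4.5 (4.38) p.674 (A = 0 model)] -/
theorem etaRateIneq342_kingOpSC_of_le (hL : 2 ≤ L) (a m2 s : ℝ) (j : KingPotIdx d × Fin (d + 1))
    (v : ∀ N : ℕ, Tor (fine N (kingU d L j.1.e)) → ℝ) {B δ γ : ℝ} (hB : 0 ≤ B) (hδ : 0 ≤ δ)
    (hK : ∀ x z : Tor (kingU d L j.1.e),
      |kingKerMat L a m2 s j.1 v x z| ≤ B * Real.exp (-(δ * tdistT (kingU d L j.1.e) x z)) * (((L : ℝ) ^ j.1.k) ^ (-γ))) :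
    EtaRateIneq342 (kingOpSC L a m2 s j) (4 * ((d : ℝ) + 1) * Real.exp δ * B) δ γ v := by
  obtain ⟨i, ν⟩ := j
  have hLpos : (0 : ℝ) < L := by exact_mod_cast (show 0 < L by omega)
  have hη : 0 < (kingGeo L i.k (kingU d L i.e) i.Msz).eta := by
    show 0 < (((L : ℝ) ^ i.k))⁻¹; positivity
  have hrate : 0 ≤ ((L : ℝ) ^ i.k) ^ (-γ) := Real.rpow_nonneg (by positivity) _
  have hB' : 0 ≤ 4 * ((d : ℝ) + 1) * Real.exp δ * B := by positivity
  -- pointwise kernel bound with the rate absorbed into the constant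
  have hK' : ∀ x z : Tor (kingU d L i.e), |kingKerMat L a m2 s i v x z|
      ≤ (B * ((L : ℝ) ^ i.k) ^ (-γ)) * Real.exp (-(δ * tdistT (kingU d L i.e) x z)) := fun x z =>
    (hK x z).trans (le_of_eq (by ring))
  have hlen : ∀ y : Tor (kingU d L i.e), (opGeo (kingGeo L i.k (kingU d L i.e) i.Msz) (Tor (kingU d L i.e)) (fun x => x)).len y = 1 :=
    fun y => by rw [opGeo_len]; exact kingGeo_len (NeZero.ne L) i.k (kingU d L i.e) i.Msz y
  have hrf : ∀ w : Tor (kingU d L i.e), rateFactor (opGeo (kingGeo L i.k (kingU d L i.e) i.Msz) (Tor (kingU d L i.e)) (fun x => x)) γ w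
      = ((L : ℝ) ^ i.k) ^ (-γ) := fun w => by
    rw [rateFactor_opGeo _ _ _ hη.ne' hLpos, T4EtaRateDefect.rateWeight]
  have hpref : ∀ m : Fin 4, B9.pref4 (1 : ℝ) m = 1 := fun m => by
    fin_cases m <;> simp [B9.pref4]
  have key : ∀ m : Fin 4, HasMaj (BlockNorm.ofBlocks (kingGeo L i.k (kingU d L i.e) i.Msz) (fun x => x))
      (BlockNorm.ofBlocks (kingGeo L i.k (kingU d L i.e) i.Msz) (fun x => x)) (kingOpsSC L a m2 s (i, ν) m v)
      (fun y y' => (4 * ((d : ℝ) + 1) * Real.exp δ * B)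
        * B9.pref4 ((opGeo (kingGeo L i.k (kingU d L i.e) i.Msz) (Tor (kingU d L i.e)) (fun x => x)).len y) m
        * Real.exp (-(δ * (kingGeo L i.k (kingU d L i.e) i.Msz).dist y y'))
        * max (rateFactor (opGeo (kingGeo L i.k (kingU d L i.e) i.Msz) (Tor (kingU d L i.e)) (fun x => x)) γ y)
            (rateFactor (opGeo (kingGeo L i.k (kingU d L i.e) i.Msz) (Tor (kingU d L i.e)) (fun x => x)) γ y')) := fun m => by
    have hm := hasMaj_ofBlocks_of_entry_le (g := kingGeo L i.k (kingU d L i.e) i.Msz) (fun x => x) (fun x => x)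
      (T := kingOpsSC L a m2 s (i, ν) m v)
      (κ := fun y y' => 4 * ((d : ℝ) + 1) * Real.exp δ * (B * ((L : ℝ) ^ i.k) ^ (-γ))
        * Real.exp (-(δ * tdistT (kingU d L i.e) y y')))
      (n₀ := 1) (fun _ _ => by positivity) (fun y' => card_fibre_self_le_one y')
      (fun x z => torOps_single_le (kingU d L i.e) hδ (by positivity) hK' ν m x z)
    refine hm.mono fun y y' => le_of_eq ?_
    rw [hlen, hpref, hrf, hrf, max_self]
    show ((1 : ℕ) : ℝ) * (4 * ((d : ℝ) + 1) * Real.exp δ * (B * ((L : ℝ) ^ i.k) ^ (-γ)) * Real.exp (-(δ * tdistT (kingU d L i.e) y y')))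
      = 4 * ((d : ℝ) + 1) * Real.exp δ * B * 1 * Real.exp (-(δ * tdistT (kingU d L i.e) y y')) * ((L : ℝ) ^ i.k) ^ (-γ)
    push_cast; ring
  exact etaRateIneq342_of_hasMaj (g := kingGeo L i.k (kingU d L i.e) i.Msz) (B := potBgSC L s (kingU d L i.e)) (fun x => x) (fun x => x)
    hη.le hLpos.le hB' (kingOpsSC L a m2 s (i, ν)) v key

end Family

/-! ## §3 `NE2PlusOperator` ∕ `NE2ZeroOperator` BY NAME with the potential live -/

section OperatorLayer

variable (L : ℕ) [NeZero L]

/-- **`NE2PlusOperator` IS INHABITED BY THE DRESSED COVARIANCES' ENTRY FAMILY WITH THE POTENTIAL LIVE — BY NAME** (odd `L ≥ 3`, `a, m² > 0`,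
`c₃₅ > 0`, `0 ≤ s ≤ L^{−1∕2}`): constants `(M₅, δ₀, a₀, B₀′, γ) = (1, δ₀, a₀, 4(d+1)e^{δ₀}B₀, −log θ∕log L)` from part 10d's uniform dressed (4.38)
(`B₀e^{−δ₀|y−y′|}θ^k` over the (3.35)∧(3.36)-window), uniform in the index AND in the regular tower.  HONEST SCOPE: module docstring.
[cite: Balaban1985BackgroundPropagators, Thm 3.1 (3.42) p.397 + Thm 3.14 pp.426–427 (quantifier template); King1986, Lemma 4.5 (4.38) p.674 (A = 0 model)] -/
theorem ne2PlusOperator_kingSC (hLodd : Odd L) (hL : 2 ≤ L) {a m2 : ℝ} (ha : 0 < a) (hm : 0 < m2) {c35 : ℝ} (hc : 0 < c35)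
    {s : ℝ} (hs0 : 0 ≤ s) (hs1 : s ≤ (L : ℝ) ^ (-(1 / 2 : ℝ))) :
    NE2PlusOperator c35 (kingInstanceSCν (d := d) L s) (kingOpSC L a m2 s) := by
  obtain ⟨δ₀, a₀, B₀, θ, hδ₀, ha₀, hB₀, hθ0, hθ1, H⟩ := ne2PlusUnit_kingVW (d := d) L hLodd hL ha hm hc hs0 hs1
  have hL1 : (1 : ℝ) < L := by exact_mod_cast (show 1 < L by omega)
  obtain ⟨hγ, hθk⟩ := pow_eq_rpow_rate hθ0 hθ1 hL1
  refine ⟨1, δ₀, a₀, 4 * ((d : ℝ) + 1) * Real.exp δ₀ * B₀, -Real.log θ / Real.log L, one_pos, hδ₀, ha₀, by positivity, hγ,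
    fun j _ α₀ hα hMa v h335 => ?_⟩
  refine etaRateIneq342_kingOpSC_of_le L hL a m2 s j v hB₀.le hδ₀.le fun x z => ?_
  rw [← hθk]
  exact H j.1 α₀ hα hMa v h335.1 h335.2 x z trivial trivial

/-- **`NE2ZeroOperator`** for the dressed entry family (the trivial tower is (3.35)-regular in the size-and-coherence reading at every `α₀ > 0`).
[cite: King1986, Lemma 4.5 (4.38) p.674 (A = 0 model)] -/
theorem ne2ZeroOperator_kingSC (hLodd : Odd L) (hL : 2 ≤ L) {a m2 : ℝ} (ha : 0 < a) (hm : 0 < m2) {s : ℝ} (hs0 : 0 ≤ s)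
    (hs1 : s ≤ (L : ℝ) ^ (-(1 / 2 : ℝ))) :
    NE2ZeroOperator (kingInstanceSCν (d := d) L s) (kingOpSC L a m2 s) := by
  refine ne2Zero_of_ne2Plus (c35 := 1) (fun j α₀ hα => ⟨fun N x => ?_, fun k _ x' => ?_⟩)
    (ne2PlusOperator_kingSC L hLodd hL ha hm one_pos hs0 hs1)
  · show |(0 : ℝ)| ≤ 1 * α₀
    rw [abs_zero]; positivity
  · show |(0 : ℝ) - 0| ≤ 1 * α₀ * s ^ k
    rw [sub_zero, abs_zero]; positivity

end OperatorLayer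

/-! ## §4 The node's K4 face `N15At` on the dressed carriers -/

section Node

/-- **THE DRESSED KING CARRIERS OF NODE N15** (`YMDAG.UVSplit.NE2Carriers`): index `KingPotIdx d × Fin (d+1)`, the dressed family with the
size-and-coherence POTENTIAL SORT LIVE, the operator-layer entry family of the dressed covariances' η-difference, the dressed minimiser's sup entries
in the site slot (part 15), the dressed covariances' η-difference in the unit slot (parts 10d ∕ 15), `inΛ := True`, `unitDist := tdistT`; `c₃₅`, `p` free.
[cite: King1986, Prop. 3.8 (3.71) p.664 + Lemma 4.5 (4.38) p.674 (the objects, A = 0); Balaban1985BackgroundPropagators, Thm 3.1 p.397 + Thm 3.14 pp.426–427 + Thm 3.15 p.432 (shapes)] -/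
def kingCarriersSC (d L : ℕ) [NeZero L] (a m2 s c35 p : ℝ) : NE2Carriers where
  I := KingPotIdx d × Fin (d + 1)
  c35 := c35
  p := p
  pi := kingInstanceSCν (d := d) L s
  Kop := kingOpSC L a m2 s
  Ksite := fun j => kingHSiteSC L a m2 s j.1
  Kunit := fun j => kingKerSC L a m2 s j.1
  inΛ := fun _ _ => True
  unitDist := fun j => kingDistSC L s j.1

/-- **`N15At` ON THE DRESSED KING CARRIERS — THE NODE'S K4 FACE WITH A LIVE BACKGROUND SORT** (every torus dimension `d + 1`, odd `L ≥ 3`,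
`a, m² > 0`, `c₃₅ > 0`, `0 ≤ s ≤ L^{−1∕2}`, every `p`): `NE2PlusOperator c₃₅ _ (dressed 𝔇(C^{(k+1)}_v, C^{(k)}_v) entries) ∧ NE2PlusSite 4 p c₃₅ _
(dressed minimiser sup entries, γ = 1∕2) ∧ NE2PlusUnit c₃₅ _ (dressed covariances) True tdistT`, each with constants UNIFORM over the index block AND
over the (3.35)-regular potential towers of the window — NE2's analogue decided in King's A = 0 scalar model with the background quantifier of the
predicates genuinely ranging over a populated sort.  NOT Bałaban's carriers of record (NODE 00: gauge fields, covariant operators); NOT a node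
discharge; count-neutral. [cite: King1986, Prop. 3.8 (3.71) p.664 + Lemma 4.5 (4.38) p.674 (A = 0 model); Balaban1985BackgroundPropagators, Thm 3.1 p.397 + Thm 3.14 pp.426–427 + Thm 3.15 (3.187) p.432 (quantifier templates)] -/
theorem n15At_kingModelSC (d : ℕ) {L : ℕ} [NeZero L] (hLodd : Odd L) (hL : 2 ≤ L) {a m2 : ℝ} (ha : 0 < a) (hm : 0 < m2)
    {c35 : ℝ} (hc : 0 < c35) {s : ℝ} (hs0 : 0 ≤ s) (hs1 : s ≤ (L : ℝ) ^ (-(1 / 2 : ℝ))) (p : ℝ) :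
    N15At (kingCarriersSC d L a m2 s c35 p) := by
  refine ⟨ne2PlusOperator_kingSC L hLodd hL ha hm hc hs0 hs1, ?_, ?_⟩
  · obtain ⟨M₅, δ, a₀, C, γ, hM, hδ, ha₀, hC, hγ, H⟩ := ne2PlusSite_kingHSC (d := d) L hLodd hL ha hm hc hs0 hs1 4 p
    exact ⟨M₅, δ, a₀, C, γ, hM, hδ, ha₀, hC, hγ, fun j => H j.1⟩
  · obtain ⟨δ₀, a₀, B₀, θ, hδ, ha₀, hB, hθ0, hθ1, H⟩ := ne2PlusUnit_kingSC (d := d) L hLodd hL ha hm hc hs0 hs1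
    exact ⟨δ₀, a₀, B₀, θ, hδ, ha₀, hB, hθ0, hθ1, fun j => H j.1⟩

/-- **THE FOUR-TORUS INSTANCE** (`d + 1 = 4`, the dimension of the T⁴ programme). [cite: King1986, Lemma 4.5 (4.38) p.674 (A = 0 model)] -/
theorem n15At_kingModelSC_dim4 {L : ℕ} [NeZero L] (hLodd : Odd L) (hL : 2 ≤ L) {a m2 : ℝ} (ha : 0 < a) (hm : 0 < m2) {c35 : ℝ}
    (hc : 0 < c35) {s : ℝ} (hs0 : 0 ≤ s) (hs1 : s ≤ (L : ℝ) ^ (-(1 / 2 : ℝ))) (p : ℝ) :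
    N15At (kingCarriersSC 3 L a m2 s c35 p) :=
  n15At_kingModelSC 3 hLodd hL ha hm hc hs0 hs1 p

/-- NON-VACUITY OF THE INDEX BLOCK: the dressed carriers' index type is inhabited. [folklore] -/
theorem kingCarriersSC_index_nonempty (d L : ℕ) [NeZero L] (a m2 s c35 p : ℝ) : Nonempty (kingCarriersSC d L a m2 s c35 p).I :=
  ⟨(⟨0, 1, le_rfl, 1, le_rfl, 1, le_rfl⟩, 0)⟩

/-- NON-VACUITY OF THE BACKGROUND WINDOW: at every index and every `α₀`, the (3.35)-window of the dressed carriers' background sort contains the block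
lift of every unit-lattice field of sup `≤ c₃₅α₀` (genuinely site-dependent towers; `s ≥ 0`). [folklore] -/
theorem kingCarriersSC_window_populated {L : ℕ} [NeZero L] (a m2 : ℝ) {s : ℝ} (hs : 0 ≤ s) (c35 p : ℝ)
    (j : KingPotIdx d × Fin (d + 1)) (α₀ : ℝ) (W : Tor (kingU d L j.1.e) → ℝ) (hW : ∀ z, |W z| ≤ c35 * α₀) :
    ((kingCarriersSC d L a m2 s c35 p).pi j).Bf.Reg335 c35 α₀ (blockLift (kingU d L j.1.e) W) :=
  (potBgSC_reg_blockLift (d := d) L hs (kingU d L j.1.e) W hW).1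

end Node

end Summit.QuantumFields.YangMills.BalabanUVNodes.N15.KingModel
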